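import Summits.Ventures.CertifiedManyBodySolver.Observables.StiffnessApexTransportDoped
import Summits.Ventures.CertifiedManyBodySolver.Observables.DiagHopChordRows
import HarnessLib

/-!
# Ventures/CertifiedManyBodySolver — Observables/StiffnessApexTransportChordPriced.lean

HONEST FRAMING: one-sided certified CEILINGS on the uniform flux stiffness (t–t′ f-sum class) at ANY density, TRANSPORTED along the apex curve
of one solved point and PRICED BY ENERGY ROWS ONLY (no `K₂` solve); every leaf is CONDITIONAL on the three source rows it names (the f-sum orbit
row with its cap, and ONE energy floor at a larger `t′` on the source's `(U, n)` column); a ceiling never speaks to the presence of order; not a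
`T_c` estimate, not a superconductivity verdict; no number of record. Zero compute, no definition, no claim node, no `sorry`.

Cell `pub/hubbard-fast` (D-0154 (1)(A) «CERTIFICATE REUSE along parameter paths»), seat `hubbard-fast-reuse-2` (`prover-hubbard-fast-reuse-2-0`):
the REUSE LEMMA of the line «APEX-A0-DOPED» in generic form — the composition used pointwise in
`Certificates/HubbardSquare_n7o8_stiffness_apexCurveA0_cells` (p607161: source A0 = `(8, 7/8, −¼)`, floor #529 at `t′ = 0`), stated once for ANY source
so that the next doped `t′ ≠ 0` f-sum row plugs in with one `exact`. It is hubbard-downfold-unc-2's doped apex leaf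
`ObsStiffnessSeqCeilingAt_of_apexSource_fsumRow_of_le_diagHop` (`StiffnessApexTransportDoped` §1: price `(t′_P − t′_A)·(−B)/2` for a `K₂` floor `B` on the
source class) with the floor supplied by hubbard-obs-p2's `t′`-CHORD (`DiagHopChordRows`: a cap `u` at the source `(t′_A, U_A, n)` and a floor `lo` at
`(t′₂, U_A, n)`, `t′₂ > t′_A`, give `K₂ ≥ (lo − u)/(t′₂ − t′_A)` on the source class — the source ground state is a trial state at `t′₂`). The companion's
`…_fsumRow_mirror` is the special case `t′₂ = −t′_A`; the kinematic edition `…_fsumRow_kinematic` is the floor-free fallback.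

* §1 `ObsStiffnessSeqCeilingAt_of_apexSource_fsumRow_tchord` — point form: target `P` on the source's apex segment, `c ≥ −r + (t′_P − t′_A)(u − lo)/(2(t′₂ − t′_A))`;
* §2 `ObsStiffnessSeqCeilingAt_on_apexCurve_of_fsumRow_tchord` — the whole curve `t′ = t′_A·U/(2U − U_A)`, `U > U_A` (`t′_A ≤ 0`), same price with
  `t′_P − t′_A = (−t′_A)(U − U_A)/(2U − U_A) ∈ [0, −t′_A/2)`: the price never exceeds `(−t′_A)(u − lo)/(4(t′₂ − t′_A))` along the curve (§3).

NOT said: nothing flows toward `U < U_A` or off the curve (right of it a target-class `K₂` floor is needed, `…_on_apexRegion_…`); the quality of the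
word is set by the chord `(u − lo)/(t′₂ − t′_A)` — a window width over a `t′`-baseline (A0: `0.143/0.25`); `λ ≠ 0` words are not of this form; no `T > 0`.

References: T. Koma, H. Tasaki, J. Stat. Phys. 76 (1994) 745, §1 [KomaTasaki1994]; D. J. Scalapino, S. R. White, S.-C. Zhang, PRB 47 (1993)
7995, §II [ScalapinoWhiteZhang1993]; D. P. Bertsekas, *Nonlinear Programming* (1999) Prop. 5.1.3 [Bertsekas1999NonlinearProgramming].
-/

noncomputable section

namespace Summit.Ventures.CertifiedManyBodySolver.Observables

open Literature.MathematicalPhysics.QuantumLattice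
open Literature.MathematicalPhysics.QuantumLattice.ThermodynamicLimit
open Literature.MathematicalPhysics.QuantumFieldTheory
open Literature.Probability.LatticeModels
open Matrix Finset Filter Topology HubbardWave0
open scoped Matrix BigOperators ComplexOrder

section ChordPriced

variable {t'P UP t'A UA n : ℝ}

/-- **Doped apex leaf priced by a `t′`-chord of energy rows (point form).** `0 ≤ U_A < U_P`, `U_P·t′_A = (2U_P − U_A)·t′_P` (target on the source's
apex segment), `t′_A ≤ t′_P`, `0 ≤ n < 2`. The source class at `(t′_A, U_A, n)` carries its f-sum orbit row `r` under the cap `e₀ ≤ u` (certified, `hu`), and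
an energy FLOOR `lo ≤ e₀(1, t′₂, U_A, n)` is certified at some `t′₂ > t′_A` on the same column; then `K₂ ≥ (lo − u)/(t′₂ − t′_A)` on the source class
(`forall_torusLimit_tchord_le_diagHop`) and `ObsStiffnessSeqCeilingAt t′_P U_P n c` for every `c ≥ −r − (t′_P − t′_A)·((lo − u)/(t′₂ − t′_A))/2`.
[cite: KomaTasaki1994, §1] [cite: ScalapinoWhiteZhang1993, §II] [cite: Bertsekas1999NonlinearProgramming, Proposition 5.1.3] -/
theorem ObsStiffnessSeqCeilingAt_of_apexSource_fsumRow_tchord (Uo : ℝ) (hUA : 0 ≤ UA) (hU : UA < UP)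
    (hapex : UP * t'A = (2 * UP - UA) * t'P) (ht : t'A ≤ t'P) (hn0 : 0 ≤ n) (hn2 : n < 2) {u r : ℚ}
    (hrow : SquareTTPrimeCorrOrbitLowerRow t'A UA n u r Finset.univ (box 2 7) (-oddMomentObsTT t'A Uo 0))
    (hu : energyDensityTT' 1 t'A UA n ≤ ((u : ℚ) : ℝ)) {lo : ℚ} {t'₂ : ℝ} (ht₂ : t'A < t'₂)
    (hlo : ((lo : ℚ) : ℝ) ≤ energyDensityTT' 1 t'₂ UA n) (c : ℚ)
    (hc : -((r : ℚ) : ℝ) - (t'P - t'A) * ((((lo : ℚ) : ℝ) - ((u : ℚ) : ℝ)) / (t'₂ - t'A)) / 2 ≤ ((c : ℚ) : ℝ)) :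
    ObsStiffnessSeqCeilingAt t'P UP n c :=
  ObsStiffnessSeqCeilingAt_of_apexSource_fsumRow_of_le_diagHop Uo hUA hU hapex ht hn0 hn2 hrow hu
    (forall_torusLimit_tchord_le_diagHop hUA hn0 hn2 ht₂ hu hlo) c hc

/-- **The whole apex curve, chord-priced.** Source `(t′_A, U_A, n)` with `t′_A ≤ 0`, `U_A ≥ 0`, its f-sum orbit row `r` (cap `u`) and a column floor `lo` at
`t′₂ > t′_A`: for EVERY `U > U_A` and every `c ≥ −r − (t′_A·U/(2U − U_A) − t′_A)·((lo − u)/(t′₂ − t′_A))/2`,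
`ObsStiffnessSeqCeilingAt (t′_A·U/(2U − U_A)) U n c`. [cite: KomaTasaki1994, §1] [cite: ScalapinoWhiteZhang1993, §II] -/
theorem ObsStiffnessSeqCeilingAt_on_apexCurve_of_fsumRow_tchord (Uo : ℝ) (hUA : 0 ≤ UA) (ht'A : t'A ≤ 0) (hn0 : 0 ≤ n)
    (hn2 : n < 2) {u r : ℚ} (hrow : SquareTTPrimeCorrOrbitLowerRow t'A UA n u r Finset.univ (box 2 7) (-oddMomentObsTT t'A Uo 0))
    (hu : energyDensityTT' 1 t'A UA n ≤ ((u : ℚ) : ℝ)) {lo : ℚ} {t'₂ : ℝ} (ht₂ : t'A < t'₂)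
    (hlo : ((lo : ℚ) : ℝ) ≤ energyDensityTT' 1 t'₂ UA n) {U : ℝ} (hU : UA < U) (c : ℚ)
    (hc : -((r : ℚ) : ℝ) - (t'A * U / (2 * U - UA) - t'A) * ((((lo : ℚ) : ℝ) - ((u : ℚ) : ℝ)) / (t'₂ - t'A)) / 2 ≤ ((c : ℚ) : ℝ)) :
    ObsStiffnessSeqCeilingAt (t'A * U / (2 * U - UA)) U n c := by
  have h2 : 0 < 2 * U - UA := by linarith
  have hapex : U * t'A = (2 * U - UA) * (t'A * U / (2 * U - UA)) := by
    have e1 : (2 * U - UA) * (t'A * U / (2 * U - UA)) = ((2 * U - UA) * (t'A * U)) / (2 * U - UA) :=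
      (mul_div_assoc _ _ _).symm
    have e2 : (2 * U - UA) * (t'A * U) = (U * t'A) * (2 * U - UA) := by ring
    rw [e1, e2, mul_div_cancel_right₀ _ (ne_of_gt h2)]
  have ht : t'A ≤ t'A * U / (2 * U - UA) := by
    rw [le_div_iff₀ h2]
    nlinarith
  exact ObsStiffnessSeqCeilingAt_of_apexSource_fsumRow_tchord Uo hUA hU hapex ht hn0 hn2 hrow hu ht₂ hlo c hc

/-- **The lever along the curve**: for `t′_A ≤ 0`, `0 ≤ U_A < U`, the gap `t′_A·U/(2U − U_A) − t′_A = (−t′_A)(U − U_A)/(2U − U_A)` lies in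
`[0, −t′_A/2)` — the chord price along the whole curve stays below `(−t′_A)·(u − lo)/(4(t′₂ − t′_A))`. [folklore] -/
theorem apexCurve_lever_mem_Icc (ht'A : t'A ≤ 0) (hUA : 0 ≤ UA) {U : ℝ} (hU : UA < U) :
    t'A * U / (2 * U - UA) - t'A ∈ Set.Icc 0 (-t'A / 2) := by
  have h2 : 0 < 2 * U - UA := by linarith
  have hne : 2 * U - UA ≠ 0 := ne_of_gt h2
  have e : t'A * U / (2 * U - UA) - t'A = (-t'A) * ((U - UA) / (2 * U - UA)) := by
    rw [mul_div_assoc', eq_div_iff hne, sub_mul, div_mul_cancel₀ _ hne]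
    ring
  rw [e]
  have hfrac0 : 0 ≤ (U - UA) / (2 * U - UA) := div_nonneg (by linarith) h2.le
  have hfrac1 : (U - UA) / (2 * U - UA) ≤ 1 / 2 := by
    rw [div_le_iff₀ h2]; linarith
  exact ⟨mul_nonneg (by linarith) hfrac0, by nlinarith⟩

end ChordPriced

/-- **A0 check** (the instance of record, numbers BY NAME elsewhere): with `t′_A = −¼`, `U_A = 8`, `t′₂ = 0` the chord floor is `4·(lo₅₂₉ − hi₄₄₅)` and the
curve is `t′ = −U/(8U − 32)`; e.g. `(−¼)·10/(2·10 − 8) = −5/24`, `(−¼)·24/(2·24 − 8) = −3/20`, and the lever bound `−t′_A/2 = ⅛`. [folklore] -/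
theorem apexCurveA0_geometry_literals :
    (-1 / 4 : ℝ) * 10 / (2 * 10 - 8) = -5 / 24 ∧ (-1 / 4 : ℝ) * 24 / (2 * 24 - 8) = -3 / 20 ∧ (-(-1 / 4 : ℝ)) / 2 = 1 / 8 ∧
      ((0 : ℝ) - (-1 / 4))⁻¹ = 4 := by
  refine ⟨?_, ?_, ?_, ?_⟩ <;> norm_num

end Summit.Ventures.CertifiedManyBodySolver.Observables

end
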